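import Mathlib

/-!
# T5Quantifier — the quantifier bookkeeping of the period hypothesis (N)

Kernel annex of seat p7 (support for the Tier-5 sub-steps N0 / N1 of the cell pub-hodge-repro2;
prose counterparts: route/T5-N0-p5.md (N0.2)(q1)–(q3), route/T5-ID-p2.md ID-5, route/T4-A3-p5.md
Lemma A7.3(a)–(c), route/T4A-route-3.md Lemma 11.2(a) and §11.5).

Each statement is the linear algebra behind ONE step of the prose; nothing about varieties,
Shimura surfaces, Schwartz data or automorphic forms is asserted — the period map
`(φ, q) ↦ I_σ(φ, q)` of route-3 Lemma 11.2 enters only as an abstract multilinear map `f`,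
the components `S_j` of `S` only as the index set of a finite sum, and the pairing
`⟨F_A, F_B⟩` only as a value in a module over a field.

* `ne_zero_iff_exists_apply_ne_zero` — (N0.2)(q3) / Lemma A7.3(b): «(N) holds for SOME admissible
  choice» is the statement that the (multilinear) period map is non-zero.
* `apply_eq_zero_of_forall_mem_span`, `exists_apply_ne_zero_of_ne_zero` — route-3 Lemma 11.2(a) in
  the form the cell uses it: a multilinear map vanishing on every tuple of vectors drawn from
  spanning sets is zero; hence a non-zero multilinear map is non-zero at some tuple of
  rational points (they span the ℂ-space) or of lattice points (they span the ℚ-space).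
* `apply_smul_ne_zero_iff` — T4A-route-3 §11.5: `I(Nφ, Mq) = N⁴M⁴ · I(φ, q)`, so the rational and the
  integral readings of the quantifier of (N) agree.
* `exists_term_ne_zero_of_sum_ne_zero`, `exists_map_ne_zero_of_map_sum_ne_zero`,
  `exists_inner_ne_zero_of_inner_sum_ne_zero` — Lemma A7.3(c) (`∫_S = Σ_j ∫_{S_j}`: (N) for `S`
  gives (N) for one component) and the Hecke-isolation step of ID-5 / MEMO §9.3(c) («a translate of
  `η_aη_b` is a finite SUM of products of vertex forms …, so by linearity one product already pairs»).
* `mul_ne_zero_iff_of_left_ne_zero`, `smul_ne_zero_iff_of_left_ne_zero` — N1 / Theorem ID(iv):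
  `I = c · ⟨F_A, F_B⟩` with `c ≠ 0` gives `I ≠ 0 ↔ ⟨F_A, F_B⟩ ≠ 0`; Lemma A7.3(c)'s `deg(π) · I`.
* `exists_of_exists_at`, `ND_imp_N` — (N0.2)(q1): `(N_D) ⇒ (N)` (the existential over `σ` and over
  the admissible choice is witnessed by `σ = τ₁` and the choice found).
-/

namespace Summit.Ventures.HodgeRepro2.T5Quantifier

open Function

section Multilinear

variable {R : Type*} [Semiring R] {ι : Type*} {M : ι → Type*} {N : Type*}
  [∀ i, AddCommMonoid (M i)] [∀ i, Module R (M i)] [AddCommMonoid N] [Module R N]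

/-- (N0.2)(q3) / T4-A3 Lemma A7.3(b), the quantifier of (N): a multilinear map (the period
`(φ, q) ↦ I_σ(φ, q)` of route-3 Lemma 11.2) is non-zero iff it is non-zero at SOME tuple. -/
theorem ne_zero_iff_exists_apply_ne_zero (f : MultilinearMap R M N) :
    f ≠ 0 ↔ ∃ x : ∀ i, M i, f x ≠ 0 := by
  constructor
  · intro hf
    by_contra h
    exact hf (MultilinearMap.ext fun x => by_contra fun hx => h ⟨x, hx⟩)
  · rintro ⟨x, hx⟩ rfl
    exact hx rfl

/-- route-3 Lemma 11.2(a), vanishing half: if the multilinear map `f` vanishes on every tuple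
whose `i`-th entry lies in `s i`, then it vanishes on every tuple whose `i`-th entry lies in
`span R (s i)` (induction over the coordinates, `Submodule.span_induction` in each). -/
theorem apply_eq_zero_of_forall_mem_span [Finite ι] (f : MultilinearMap R M N)
    (s : ∀ i, Set (M i)) (h : ∀ x : ∀ i, M i, (∀ i, x i ∈ s i) → f x = 0) :
    ∀ x : ∀ i, M i, (∀ i, x i ∈ Submodule.span R (s i)) → f x = 0 := by
  classical
  cases nonempty_fintype ι
  suffices H : ∀ t : Finset ι, ∀ x : ∀ i, M i,
      (∀ i ∈ t, x i ∈ Submodule.span R (s i)) → (∀ i ∉ t, x i ∈ s i) → f x = 0 by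
    intro x hx
    exact H Finset.univ x (fun i _ => hx i) (fun i hi => absurd (Finset.mem_univ i) hi)
  intro t
  induction t using Finset.induction_on with
  | empty =>
    intro x _ hx
    exact h x (fun i => hx i (by simp))
  | insert j t hj ih =>
    intro x hxt hxs
    have hj' : x j ∈ Submodule.span R (s j) := hxt j (Finset.mem_insert_self j t)
    have key : ∀ y ∈ Submodule.span R (s j), f (update x j y) = 0 := by
      intro y hy
      induction hy using Submodule.span_induction with
      | mem y hy =>
        apply ih
        · intro i hi
          have hij : i ≠ j := fun h' => hj (h' ▸ hi)
          rw [update_of_ne hij]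
          exact hxt i (Finset.mem_insert_of_mem hi)
        · intro i hi
          by_cases hij : i = j
          · subst hij
            rw [update_self]
            exact hy
          · rw [update_of_ne hij]
            exact hxs i (by simp [Finset.mem_insert, hij, hi])
      | zero => exact f.map_update_zero x j
      | add y z _ _ hy hz => rw [f.map_update_add, hy, hz, add_zero]
      | smul a y _ hy => rw [f.map_update_smul, hy, smul_zero]
    simpa [update_eq_self] using key (x j) hj'

/-- route-3 Lemma 11.2(a), existence half (the form used by (N0.2)(q3) and §11.5): a non-zero
multilinear map is non-zero at some tuple of vectors drawn from spanning sets — for the period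
map, at some tuple of rational points (they span the ℂ-spaces `V_i ⊗ ℂ`, `V'_i ⊗ ℂ`) or of lattice
points (they span the ℚ-spaces `V_i`, `V'_i`). -/
theorem exists_apply_ne_zero_of_ne_zero [Finite ι] (f : MultilinearMap R M N)
    (s : ∀ i, Set (M i)) (hs : ∀ i, Submodule.span R (s i) = ⊤) (hf : f ≠ 0) :
    ∃ x : ∀ i, M i, (∀ i, x i ∈ s i) ∧ f x ≠ 0 := by
  by_contra hcon
  have hvan : ∀ x : ∀ i, M i, (∀ i, x i ∈ s i) → f x = 0 :=
    fun x hx => by_contra fun hfx => hcon ⟨x, hx, hfx⟩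
  apply hf
  apply MultilinearMap.ext
  intro x
  have hx : ∀ i, x i ∈ Submodule.span R (s i) := fun i => by
    rw [hs i]
    exact Submodule.mem_top
  simpa using apply_eq_zero_of_forall_mem_span f s hvan x hx

/-- The two halves together: for spanning sets `s i`, «`f ≠ 0`» ⟺ «`f` is non-zero at some tuple
drawn from the `s i`» — Lemma 11.2(a)'s «(N) for SOME `(φ, q)` ⟺ (N) for some rational /
integral `(φ, q)`». -/
theorem ne_zero_iff_exists_mem_apply_ne_zero [Finite ι] (f : MultilinearMap R M N)
    (s : ∀ i, Set (M i)) (hs : ∀ i, Submodule.span R (s i) = ⊤) :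
    f ≠ 0 ↔ ∃ x : ∀ i, M i, (∀ i, x i ∈ s i) ∧ f x ≠ 0 := by
  constructor
  · exact exists_apply_ne_zero_of_ne_zero f s hs
  · rintro ⟨x, -, hx⟩
    exact (ne_zero_iff_exists_apply_ne_zero f).mpr ⟨x, hx⟩

end Multilinear

section Scaling

variable {K : Type*} [Field K] {ι : Type*} [Fintype ι] {M : ι → Type*} {N : Type*}
  [∀ i, AddCommMonoid (M i)] [∀ i, Module K (M i)] [AddCommMonoid N] [Module K N]

/-- T4A-route-3 §11.5: rescaling the arguments of a multilinear map by non-zero scalars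
(`Nφ_i`, `Mq_i`) multiplies its value by the product of the scalars (`N⁴M⁴`), so non-vanishing at
a rational point and at the corresponding integral point are the same statement. -/
theorem apply_smul_ne_zero_iff (f : MultilinearMap K M N) (c : ι → K) (hc : ∀ i, c i ≠ 0)
    (x : ∀ i, M i) : (f fun i => c i • x i) ≠ 0 ↔ f x ≠ 0 := by
  rw [f.map_smul_univ]
  exact smul_ne_zero_iff_right (Finset.prod_ne_zero_iff.mpr fun i _ => hc i)

end Scaling

section Sums

/-- Lemma A7.3(c), first half (`∫_S = Σ_j ∫_{S_j}` over the connected components): a non-zero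
finite sum has a non-zero term, so (N) for `S` gives (N) for some component `S_j`. -/
theorem exists_term_ne_zero_of_sum_ne_zero {α β : Type*} [AddCommMonoid β] (s : Finset α)
    (g : α → β) (h : ∑ a ∈ s, g a ≠ 0) : ∃ a ∈ s, g a ≠ 0 :=
  Finset.exists_ne_zero_of_sum_ne_zero h

/-- The Hecke-isolation step of ID-5 / MEMO §9.3(c) in its general form: if an additive map `L`
(pairing against a fixed form) is non-zero on a finite sum, it is non-zero on one of the terms. -/
theorem exists_map_ne_zero_of_map_sum_ne_zero {α β γ : Type*} [AddCommMonoid β]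
    [AddCommMonoid γ] (L : β →+ γ) (s : Finset α) (F : α → β)
    (h : L (∑ a ∈ s, F a) ≠ 0) : ∃ a ∈ s, L (F a) ≠ 0 := by
  rw [map_sum] at h
  exact Finset.exists_ne_zero_of_sum_ne_zero h

/-- The Hecke-isolation step of ID-5 for an inner product (the Petersson / L² pairing): if
`⟨Σ_k F_k, G⟩ ≠ 0` then `⟨F_k, G⟩ ≠ 0` for some `k` — «a translate of `η_aη_b` is a finite SUM of
products of vertex forms with translated Schwartz data, so by linearity one product already
pairs». -/
theorem exists_inner_ne_zero_of_inner_sum_ne_zero {𝕜 E : Type*} [RCLike 𝕜]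
    [NormedAddCommGroup E] [InnerProductSpace 𝕜 E] {α : Type*} (s : Finset α) (F : α → E)
    (G : E) (h : inner 𝕜 (∑ a ∈ s, F a) G ≠ 0) : ∃ a ∈ s, inner 𝕜 (F a) G ≠ 0 := by
  rw [sum_inner] at h
  exact Finset.exists_ne_zero_of_sum_ne_zero h

end Sums

section Constants

/-- N1 / Theorem ID(iv): if `I = c · P` with `c ≠ 0` (the volume / orientation constant of the
identification `∫_S ω_{ab} ∧ \overline{ω_{cd}} = c · ⟨F_A, F_B⟩`), then `I ≠ 0 ↔ P ≠ 0`. Also Lemma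
A7.3(c)'s `∫_{S'} (f ∘ π)^* w_σ = deg(π) · ∫_S f^* w_σ` with `deg π ≥ 1`. -/
theorem mul_ne_zero_iff_of_left_ne_zero {K : Type*} [Field K] {c I P : K} (hc : c ≠ 0)
    (h : I = c * P) : I ≠ 0 ↔ P ≠ 0 := by
  subst h
  exact mul_ne_zero_iff_left hc

/-- The same for a scalar multiple in a vector space over a field (the pairing as a vector). -/
theorem smul_ne_zero_iff_of_left_ne_zero {K V : Type*} [Field K] [AddCommGroup V] [Module K V]
    {c : K} {I P : V} (hc : c ≠ 0) (h : I = c • P) : I ≠ 0 ↔ P ≠ 0 := by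
  subst h
  exact smul_ne_zero_iff_right hc

end Constants

section Assembly

/-- (N0.2)(q1): a statement proved for ONE value `σ₀` of a parameter proves the existential
over the parameter — `(N_D)` (at `σ = τ₁`) implies `(N)` (for some `σ ∈ Σ`). -/
theorem exists_of_exists_at {S : Type*} (P : S → Prop) (σ₀ : S) (h : P σ₀) : ∃ σ, P σ :=
  ⟨σ₀, h⟩

/-- (N0.2) in full: (N) quantifies over `σ` and over the admissible choices `D`; `(N_D)` exhibits
`σ = τ₁` and one admissible choice with a non-zero period, hence (N). The period is an abstract
function `I : S → Choice → K`; `Adm` is the admissibility predicate of (N0.1)(b). -/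
theorem ND_imp_N {S Choice K : Type*} [Zero K] (Adm : Choice → Prop) (I : S → Choice → K)
    (τ₁ : S) (hND : ∃ D, Adm D ∧ I τ₁ D ≠ 0) : ∃ σ, ∃ D, Adm D ∧ I σ D ≠ 0 :=
  ⟨τ₁, hND⟩

end Assembly

end Summit.Ventures.HodgeRepro2.T5Quantifier
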